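import Literature.Topology.FourManifolds.LatticeFormsOrientationCharacterRestriction
import Literature.Topology.FourManifolds.LatticeFormsDivisorOneStabiliserQuotient
import Literature.Topology.FourManifolds.LatticeFormsStableOrthogonalGroupReflections
import HarnessLib

/-!
# `[O⁺(L) : Õ⁺(L)] = [O(L) : Õ(L)] = |O(q_L)|` (Gritsenko–Hulek–Sankaran, *Doc. Math.* 12 (2007) Lemma 4.2, middle row)
# and `[O⁺(L, h) : Õ⁺(L, h)] = [O(L, h) : Õ(L, h)]` (*Compositio Math.* 146 (2010) Remark 3.4 with Prop. 4.12 (ii))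

Trunk T-4MAN vocabulary; the `O⁺` companion of `LatticeFormsStableOrthogonalGroupIndex.lean` (row g39-#3: the TOP row
`[O(L) : Õ(L)] = N = |O(q_L)|` of GHS 2007 Lemma 4.2 for even `L ≅ Q ⊕ U^{⊕r}`, and `[O(Λ_d) : Õ(Λ_d)] = 2^{ρ(d)}`) and of
`LatticeFormsDivisorOneStabiliserQuotient.lean` (row g42: Prop. 4.12 (ii) for `div h = 1`, `|O(L, h)|_{h^⊥} ∕ Õ| = |O(q_L)|`,
`= 2^{ρ(t)}` in the models), using the orientation character `IsometryEquiv.IsOrientationPreserving`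
(`LatticeFormsOrientationCharacter.lean`: `O⁺(L)`, "real spin norm `1`"; `σ_v ∉ O⁺` for `v² = 2`:
`isOrientationPreserving_normTwoReflectionEquiv_iff`), `σ̄_v = id` (`LatticeFormsStableOrthogonalGroupReflections.lean`:
`discriminantGroupCongr_normTwoReflectionEquiv`) and `G ∈ O⁺(L) ⟺ G|_{h^⊥} ∈ O⁺(h^⊥)` for `G h = h`
(`LatticeFormsOrientationCharacterRestriction.lean`, row g47-#2). Written for lane `lit-hodgefound` (Track 2 foundations;
prover seat `lit-hodgefound-p18`, gen 47, row g47-#6). THEOREMS ONLY — no definition, no named fact, no instance, no notation.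

## Sources, verbatim

V. Gritsenko, K. Hulek, G. K. Sankaran, *The Hirzebruch–Mumford volume for the orthogonal group and applications*,
Doc. Math. 12 (2007) 215–241, §4 (held text `paper:arxiv-math_0512595` p. 9): "**Lemma 4.2.** Let `N = |O(q_L)|`. Then we
have the following diagram of groups with indices as indicated: `Õ(L) ⊂ O(L)` (`N:1`), `Õ⁺(L) ⊂ O⁺(L)` (`N:1`),
`S̃O⁺(L) ⊂ SO⁺(L)` (`N:1`) [vertical inclusions `2:1`]. *Proof.* […] we choose a hyperbolic plane `U` in `L`, which exists
by assumption. Let `e₁, e₂` be a basis of `U` with `e₁² = e₂² = 0` and `e₁.e₂ = 1`. If `u = e₁ − e₂`, `v = e₁ + e₂`, then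
`u² = −2`, `v² = 2` and the two reflections `σ_u` and `σ_v` belong to `Õ(L)`, since they act trivially on the orthogonal
complement of `U`. Moreover `sn_{−1}(σ_v) = −1` and `sn_{−1}(σ_u) = 1`. […] Taking into account that the reflections `σ_u`
and `σ_v` act trivially on the discriminant form, we obtain that `N = [O(L):Õ(L)] = [O⁺(L):Õ⁺(L)] = [SO⁺(L):S̃O⁺(L)]`."

V. Gritsenko, K. Hulek, G. K. Sankaran, *Moduli spaces of irreducible symplectic manifolds*, Compositio Math. 146 (2010)
404–434, §3 (held text `paper:arxiv-0802.2078` p. 9): "**Remark 3.4.** The lifting of the map `φ` to `φ̃` is not unique.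
Two markings `ψ₀` and `ψ₁` define the same lifting if and only if `ψ₀ ∘ ψ₁⁻¹` is trivial in
`PO⁺(L_{2n−2},h)/PÕ⁺(L_{2n−2},h)`, so the different liftings are classified by the quotient `PO⁺(L_{2n−2},h)/PÕ⁺(L_{2n−2},h)`.
We shall compute the index of `Õ⁺(L_{2n−2},h)` in `O⁺(L_{2n−2},h)` below (Proposition 4.12), in almost all cases."
§4 Prop. 4.12 (ii) (p. 12): "The factor group `O(L_{2t}, h_d)/Õ(L_{2t}, h_d)` is an abelian `2`-group, which is of order
`2^{ρ(t/f)}` if `f` is odd."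

## Contents (all proved) and reading notes

* READING. Prop. 4.12 (ii) is printed for `O ∕ Õ`, Remark 3.4 uses it for `O⁺ ∕ Õ⁺`; the step "index with `⁺` = index
  without `⁺`" is exactly the `σ_v`-argument of the 2007 Lemma 4.2, run inside `h^⊥` (which for `L_{2t}`, `h` primitive,
  contains a hyperbolic plane). This file proves that step once, abstractly (§1), and reads off both printed statements.
* §1 **Coset transfer** (`Q` symmetric non-degenerate on a finite free `ℤ`-module): if `σ ∈ Õ(L) ∖ O⁺(L)` and a family
  `P ⊆ O(L)` is stable under `γ ↦ γσ`, then the classes of `{γ ∈ P}` and of `{γ ∈ P | γ ∈ O⁺}` under "same action on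
  `A_L`" are equinumerous (`natCard_quot_and_isOrientationPreserving_eq_natCard_quot`; `P = O(L)`:
  `natCard_quot_isOrientationPreserving_eq_natCard_quot`, and with `σ = σ_v`, `v² = 2`: `…_of_apply_self_eq_two`).
* §2 **Lemma 4.2, middle row: `[O⁺(L) : Õ⁺(L)] = |O(q_L)|`** for even non-degenerate `L ≅ Q ⊕ U^{⊕r}`, `r ≥ 1`
  (`natCard_quot_isOrientationPreserving_eq_natCard_discriminantIsometry`).
* §3 **Remark 3.4 ∕ Prop. 4.12 (ii)⁺**: for `B` non-degenerate symmetric, `(h, h) ≠ 0` and a `(+2)`-vector `v ∈ h^⊥`, the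
  restrictions of `O⁺(L, h) = O⁺(L) ∩ O(L, h)` to `h^⊥` modulo equal action on `A_{h^⊥}` (i.e. modulo
  `Õ⁺(h^⊥) ≅ Õ⁺(L, h)`, rows g47-#4∕#5) are as many as those of `O(L, h)`
  (`natCard_quot_exists_isOrientationPreserving_apply_eq_eq`); hence `= |O(q_L)|` for `div h = 1`, `L` even, `U ⊂ h^⊥`
  (`…_of_apply_eq_one_of_isotropic`).
* §4 Models: `[O⁺(Λ_d) : Õ⁺(Λ_d)] = 2^{ρ(d)}` for `Λ_d = ℓ^⊥ ⊂ Λ_{K3}` and for `L_{2d} = 2E₈(−1) ⊕ 2U ⊕ ⟨−2d⟩`;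
  `[O⁺(L, h_d) : Õ⁺(L, h_d)] = 2^{ρ(t)}` for the split `h_d = e₁ + d f₁` in `2E₈(−1) ⊕ 2U ⊕ ⟨−2t⟩` and in
  `E₈(−1)^{⊕m} ⊕ U^{⊕(k+2)} ⊕ ⟨−2t⟩` (GHS 2010's `L_{2t} = L_{K3} ⊕ ⟨−2t⟩`: `m = 2`, `k = 1`).
* GROUPS, as in the sibling files: no quotient groups are formed — "`[Γ : Γ̃] = N`" is `Nat.card` of the classes of `Γ`
  under `γ̄ = γ̄'` (the cosets of the stable subgroup, `discriminantGroupCongr_eq_iff`); `O⁺ = IsOrientationPreserving`;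
  the `P`-versions (`PΓ = Γ/±1`) and the bottom row `SO⁺` of Lemma 4.2 are not in this file.

## References

* [GritsenkoHulekSankaran2007HM] V. Gritsenko, K. Hulek, G. K. Sankaran, The Hirzebruch–Mumford volume for the orthogonal
  group and applications, Doc. Math. 12 (2007) 215–241 (arXiv:math/0512595): §4 Lemma 4.2 and its proof, Lemma 4.3.
* [GritsenkoHulekSankaran2010Symplectic] V. Gritsenko, K. Hulek, G. K. Sankaran, Moduli spaces of irreducible symplectic
  manifolds, Compositio Math. 146 (2010) 404–434 (arXiv:0802.2078): §3 Thm. 3.3, Remarks 3.4–3.5; §4 Prop. 4.12 (ii),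
  Example 4.8.
* [Huybrechts2016K3] D. Huybrechts, Lectures on K3 surfaces (2016), Ch. 7 §5.4 (spinor norm of reflections), Ch. 14
  Cor. 2.7, Example 1.11 (i).
-/

noncomputable section

open Module Function
open LinearMap (BilinForm)
open Literature.Topology.FourManifolds
open Literature.AlgebraicGeometry.Surfaces

namespace LinearMap.BilinForm

/-! ### §1 Coset transfer along an orientation-reversing element of the stable orthogonal group -/

section Transfer

variable {L : Type*} [AddCommGroup L] [Module.Finite ℤ L] [Module.Free ℤ L] (Q : BilinForm ℤ L)

omit [Module.Finite ℤ L] [Module.Free ℤ L] in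
/-- The classes of `{γ | P γ}` under "`γ̄ = γ̄'`" are in bijection with the image `{γ̄ | P γ}` in `GL(A_L)`. [folklore] -/
private theorem natCard_quot_subtype_eq_natCard_range (P : Q.IsometryEquiv Q → Prop) :
    Nat.card (Quot fun γ γ' : {γ : Q.IsometryEquiv Q // P γ} ↦
        γ.1.discriminantGroupCongr = γ'.1.discriminantGroupCongr) =
      Nat.card {φ : Q.discriminantGroup ≃ₗ[ℤ] Q.discriminantGroup //
        ∃ γ : Q.IsometryEquiv Q, P γ ∧ γ.discriminantGroupCongr = φ} := by
  refine Nat.card_eq_of_bijective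
    (Quot.lift (fun γ : {γ : Q.IsometryEquiv Q // P γ} ↦
        (⟨γ.1.discriminantGroupCongr, γ.1, γ.2, rfl⟩ :
          {φ : Q.discriminantGroup ≃ₗ[ℤ] Q.discriminantGroup //
            ∃ γ : Q.IsometryEquiv Q, P γ ∧ γ.discriminantGroupCongr = φ}))
      (fun _ _ h ↦ Subtype.ext h)) ⟨?_, ?_⟩
  · rintro ⟨γ⟩ ⟨γ'⟩ h
    exact Quot.sound (Subtype.ext_iff.1 h)
  · rintro ⟨φ, γ, hγ, rfl⟩
    exact ⟨Quot.mk _ ⟨γ, hγ⟩, rfl⟩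

/-- **Coset transfer** — the mechanism of GHS's proof of Lemma 4.2 ("we can use `σ_v` to conclude … Taking into account
that the reflections `σ_u` and `σ_v` act trivially on the discriminant form, we obtain that
`N = [O(L):Õ(L)] = [O⁺(L):Õ⁺(L)]`"): let `Q` be symmetric non-degenerate, `σ ∈ O(L)` with `σ̄ = id` and `σ ∉ O⁺(L)`, and
`P` a family of isometries stable under `γ ↦ γσ` (`γ.trans σ = σ ∘ γ`). Then the classes of `P` and of `P ∩ O⁺(L)` under
"same action on `A_L`" are equinumerous: every class `γ̄`, `γ ∈ P ∖ O⁺`, is also the class of `γσ ∈ P ∩ O⁺`.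
[cite: GritsenkoHulekSankaran2007HM, §4 proof of Lemma 4.2] -/
theorem natCard_quot_and_isOrientationPreserving_eq_natCard_quot (hQ : Q.IsSymm) (hnd : Q.Nondegenerate)
    (P : Q.IsometryEquiv Q → Prop) (σ : Q.IsometryEquiv Q)
    (hσ : σ.discriminantGroupCongr = LinearEquiv.refl ℤ _) (hσ' : ¬ σ.IsOrientationPreserving)
    (hP : ∀ γ, P γ → P (γ.trans σ)) :
    Nat.card (Quot fun γ γ' : {γ : Q.IsometryEquiv Q // P γ ∧ γ.IsOrientationPreserving} ↦
        γ.1.discriminantGroupCongr = γ'.1.discriminantGroupCongr) =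
      Nat.card (Quot fun γ γ' : {γ : Q.IsometryEquiv Q // P γ} ↦
        γ.1.discriminantGroupCongr = γ'.1.discriminantGroupCongr) := by
  rw [natCard_quot_subtype_eq_natCard_range Q (fun γ ↦ P γ ∧ γ.IsOrientationPreserving),
    natCard_quot_subtype_eq_natCard_range Q P]
  refine Nat.card_congr (Equiv.subtypeEquivRight fun φ ↦ ⟨?_, ?_⟩)
  · rintro ⟨γ, ⟨hγ, -⟩, hφ⟩
    exact ⟨γ, hγ, hφ⟩
  · rintro ⟨γ, hγ, hφ⟩
    by_cases hγ' : γ.IsOrientationPreserving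
    · exact ⟨γ, ⟨hγ, hγ'⟩, hφ⟩
    · refine ⟨γ.trans σ, ⟨hP γ hγ, IsometryEquiv.isOrientationPreserving_trans_of_not_of_not hQ hnd hγ' hσ'⟩, ?_⟩
      rw [IsometryEquiv.discriminantGroupCongr_trans, hσ, LinearEquiv.trans_refl, hφ]

/-- **`[O⁺(L) : Õ⁺(L)] = [O(L) : Õ(L)]`** as soon as `Õ(L)` contains an orientation-reversing `σ` (`Q` symmetric
non-degenerate): the classes of `O⁺(L)` and of `O(L)` under "same action on `A_L`" are equinumerous (§1 with `P = O(L)`).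
[cite: GritsenkoHulekSankaran2007HM, §4 Lemma 4.2 ("`N = [O(L):Õ(L)] = [O⁺(L):Õ⁺(L)]`")] -/
theorem natCard_quot_isOrientationPreserving_eq_natCard_quot (hQ : Q.IsSymm) (hnd : Q.Nondegenerate)
    (σ : Q.IsometryEquiv Q) (hσ : σ.discriminantGroupCongr = LinearEquiv.refl ℤ _)
    (hσ' : ¬ σ.IsOrientationPreserving) :
    Nat.card (Quot fun γ γ' : {γ : Q.IsometryEquiv Q // γ.IsOrientationPreserving} ↦
        γ.1.discriminantGroupCongr = γ'.1.discriminantGroupCongr) =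
      Nat.card (Quot fun γ γ' : Q.IsometryEquiv Q ↦ γ.discriminantGroupCongr = γ'.discriminantGroupCongr) := by
  have h := Q.natCard_quot_and_isOrientationPreserving_eq_natCard_quot hQ hnd (fun _ ↦ True) σ hσ hσ'
    (fun _ _ ↦ trivial)
  refine (Nat.card_congr (Quot.congr
    (rb := fun γ γ' : {γ : Q.IsometryEquiv Q // True ∧ γ.IsOrientationPreserving} ↦
      γ.1.discriminantGroupCongr = γ'.1.discriminantGroupCongr)
    (Equiv.subtypeEquivRight fun γ : Q.IsometryEquiv Q ↦
      (⟨fun h ↦ ⟨trivial, h⟩, fun h ↦ h.2⟩ : γ.IsOrientationPreserving ↔ True ∧ γ.IsOrientationPreserving))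
    (fun _ _ ↦ Iff.rfl))).trans (h.trans (Nat.card_congr (Quot.congr
    (rb := fun γ γ' : Q.IsometryEquiv Q ↦ γ.discriminantGroupCongr = γ'.discriminantGroupCongr)
    (Equiv.subtypeUnivEquiv fun _ : Q.IsometryEquiv Q ↦ trivial) (fun _ _ ↦ Iff.rfl))))

/-- **`[O⁺(L) : Õ⁺(L)] = [O(L) : Õ(L)]` for every lattice with a `(+2)`-vector** (`Q` symmetric non-degenerate): the
reflection `σ_v`, `v² = 2`, "acts trivially on the discriminant form" and has "`sn_{−1}(σ_v) = −1`".
[cite: GritsenkoHulekSankaran2007HM, §4 proof of Lemma 4.2] [cite: Huybrechts2016K3, Ch. 7 §5.4] -/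
theorem natCard_quot_isOrientationPreserving_eq_natCard_quot_of_apply_self_eq_two (hQ : Q.IsSymm)
    (hnd : Q.Nondegenerate) {v : L} (hv : Q v v = 1 + 1) :
    Nat.card (Quot fun γ γ' : {γ : Q.IsometryEquiv Q // γ.IsOrientationPreserving} ↦
        γ.1.discriminantGroupCongr = γ'.1.discriminantGroupCongr) =
      Nat.card (Quot fun γ γ' : Q.IsometryEquiv Q ↦ γ.discriminantGroupCongr = γ'.discriminantGroupCongr) :=
  Q.natCard_quot_isOrientationPreserving_eq_natCard_quot hQ hnd (normTwoReflectionEquiv hQ v 1 hv (one_mul 1))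
    (discriminantGroupCongr_normTwoReflectionEquiv Q hQ v (Or.inl rfl) hv (one_mul 1))
    (by rw [isOrientationPreserving_normTwoReflectionEquiv_iff Q hQ hnd v 1 hv (one_mul 1)]; norm_num)

end Transfer

/-! ### §2 GHS 2007 Lemma 4.2, middle row: `[O⁺(L) : Õ⁺(L)] = N = |O(q_L)|` -/

section HyperbolicPlane

variable {M : Type*} [AddCommGroup M] [Module.Finite ℤ M] [Module.Free ℤ M] (B : BilinForm ℤ M)

/-- **GHS Lemma 4.2, middle row: `[O⁺(L) : Õ⁺(L)] = N = |O(q_L)|`** for an even non-degenerate lattice `L ≅ Q ⊕ U^{⊕r}`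
(`r ≥ 1`, "`L` contains a hyperbolic plane"): the classes of ORIENTATION-PRESERVING isometries of `L` with the same action
on the discriminant group (= the cosets of `Õ⁺(L) = Õ(L) ∩ O⁺(L)` in `O⁺(L)`) are in bijection with `O(q_L)` — by the top
row (companion file) and the coset transfer along `σ_v`, `v = e₁ + e₂ ∈ U`, `v² = 2`.
[cite: GritsenkoHulekSankaran2007HM, §4 Lemma 4.2 ("`Õ⁺(L) ⊂ O⁺(L)`, `N:1`") and its proof] [cite: Nikulin1980, Thm. 1.14.2] -/
theorem natCard_quot_isOrientationPreserving_eq_natCard_discriminantIsometry (hB : B.Nondegenerate) (hs : B.IsSymm)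
    (he : B.IsEven) {N : Type*} [AddCommGroup N] [Module.Finite ℤ N] [Module.Free ℤ N] (Q : BilinForm ℤ N)
    (hQ : Q.Nondegenerate) (hsQ : Q.IsSymm) (heQ : Q.IsEven) {r : ℕ} (hr : 0 < r)
    (hBQ : B.Equivalent (Q.prod (hyperbolicSum r))) :
    Nat.card (Quot fun g g' : {g : B.IsometryEquiv B // g.IsOrientationPreserving} ↦
        g.1.discriminantGroupCongr = g'.1.discriminantGroupCongr) =
      Nat.card {σ : B.discriminantGroup ≃ₗ[ℤ] B.discriminantGroup //
        ∀ a, B.discriminantQuad hB hs he (σ a) = B.discriminantQuad hB hs he a} := by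
  obtain ⟨e⟩ := hBQ
  -- the `(+2)`-vector `v = e⁻¹(0, e₁ + f₁)`
  have hv : B (e.symm ((0 : N), ((Pi.single ⟨0, hr⟩ 1 : Fin r → ℤ), (Pi.single ⟨0, hr⟩ 1 : Fin r → ℤ))))
      (e.symm ((0 : N), ((Pi.single ⟨0, hr⟩ 1 : Fin r → ℤ), (Pi.single ⟨0, hr⟩ 1 : Fin r → ℤ)))) = 1 + 1 := by
    rw [← e.map_app, IsometryEquiv.apply_symm_apply]
    simp [LinearMap.BilinForm.prod_apply]
  rw [← natCard_quot_isometryEquiv_eq_natCard_discriminantIsometry B hB hs he Q hQ hsQ heQ hr ⟨e⟩]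
  exact B.natCard_quot_isOrientationPreserving_eq_natCard_quot_of_apply_self_eq_two hs hB hv

end HyperbolicPlane

/-! ### §3 GHS 2010 Remark 3.4 ∕ Prop. 4.12 (ii) with `O⁺`: `[O⁺(L, h) : Õ⁺(L, h)] = [O(L, h) : Õ(L, h)]` -/

section Stabiliser

variable {M : Type*} [AddCommGroup M] [Module.Finite ℤ M] [Module.Free ℤ M] (B : BilinForm ℤ M)

/-- **`[O⁺(L, h) : Õ⁺(L, h)] = [O(L, h) : Õ(L, h)]` whenever `h^⊥` contains a `(+2)`-vector `v`** (`B` non-degenerate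
symmetric, `(h, h) ≠ 0`): the restrictions to `h^⊥` of the orientation-preserving isometries of `L` fixing `h`, modulo
equal action on `A_{h^⊥}` (i.e. modulo `Õ⁺(h^⊥) ≅ Õ⁺(L, h)`), are as many as those of all isometries fixing `h` (modulo
`Õ(h^⊥) ≅ Õ(L, h)`): coset transfer in `h^⊥` along `σ_v|_{h^⊥}`, the class of `G|` (`G ∉ O⁺`) being that of `(G σ_v)|`,
`σ_v h = h`; "`⁺`" read in `L` or in `h^⊥` alike (`IsometryEquiv.isOrientationPreserving_iff_of_apply_eq`). This is the
lattice-theoretic content of "We shall compute the index of `Õ⁺(L_{2n−2},h)` in `O⁺(L_{2n−2},h)` below (Proposition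
4.12)", Prop. 4.12 (ii) being stated for `O(L_{2t}, h_d)/Õ(L_{2t}, h_d)`.
[cite: GritsenkoHulekSankaran2010Symplectic, §3 Remark 3.4 and §4 Prop. 4.12 (ii)] [cite: GritsenkoHulekSankaran2007HM, §4 proof of Lemma 4.2] -/
theorem natCard_quot_exists_isOrientationPreserving_apply_eq_eq (hBn : B.Nondegenerate) (hB : B.IsSymm) {h : M}
    (hh : B h h ≠ 0) {v : M} (hv : v ∈ B.orthogonal (ℤ ∙ h)) (hvv : B v v = 1 + 1) :
    Nat.card (Quot fun γ γ' : {γ : (B.restrict (B.orthogonal (ℤ ∙ h))).IsometryEquiv (B.restrict (B.orthogonal (ℤ ∙ h))) //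
        ∃ G : B.IsometryEquiv B, G.IsOrientationPreserving ∧ G h = h ∧ ∀ n : B.orthogonal (ℤ ∙ h), G n = γ n} ↦
          γ.1.discriminantGroupCongr = γ'.1.discriminantGroupCongr) =
      Nat.card (Quot fun γ γ' : {γ : (B.restrict (B.orthogonal (ℤ ∙ h))).IsometryEquiv (B.restrict (B.orthogonal (ℤ ∙ h))) //
        ∃ G : B.IsometryEquiv B, G h = h ∧ ∀ n : B.orthogonal (ℤ ∙ h), G n = γ n} ↦
          γ.1.discriminantGroupCongr = γ'.1.discriminantGroupCongr) := by
  have hNnd := B.nondegenerate_restrict_orthogonal_span_singleton hBn hB hh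
  have hNs : (B.restrict (B.orthogonal (ℤ ∙ h))).IsSymm := hB.restrict _
  -- `G ∈ O⁺(L) ⟺ G|_{h^⊥} ∈ O⁺(h^⊥)` for `G h = h`
  have hiff : ∀ γ : (B.restrict (B.orthogonal (ℤ ∙ h))).IsometryEquiv (B.restrict (B.orthogonal (ℤ ∙ h))),
      (∃ G : B.IsometryEquiv B, G.IsOrientationPreserving ∧ G h = h ∧ ∀ n : B.orthogonal (ℤ ∙ h), G n = γ n) ↔
        (∃ G : B.IsometryEquiv B, G h = h ∧ ∀ n : B.orthogonal (ℤ ∙ h), G n = γ n) ∧ γ.IsOrientationPreserving :=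
    fun γ ↦ ⟨fun ⟨G, hG', hGh, hGn⟩ ↦
        ⟨⟨G, hGh, hGn⟩, (G.isOrientationPreserving_iff_of_apply_eq hB hBn hh hGh γ hGn).1 hG'⟩,
      fun ⟨⟨G, hGh, hGn⟩, hγ'⟩ ↦ ⟨G, (G.isOrientationPreserving_iff_of_apply_eq hB hBn hh hGh γ hGn).2 hγ', hGh, hGn⟩⟩
  refine (Nat.card_congr (Quot.congr
    (rb := fun γ γ' : {γ : (B.restrict (B.orthogonal (ℤ ∙ h))).IsometryEquiv (B.restrict (B.orthogonal (ℤ ∙ h))) //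
        (∃ G : B.IsometryEquiv B, G h = h ∧ ∀ n : B.orthogonal (ℤ ∙ h), G n = γ n) ∧ γ.IsOrientationPreserving} ↦
      γ.1.discriminantGroupCongr = γ'.1.discriminantGroupCongr)
    (Equiv.subtypeEquivRight hiff) (fun _ _ ↦ Iff.rfl))).trans ?_
  -- coset transfer in `h^⊥` along `σ_v|_{h^⊥}`
  have hvv' : (B.restrict (B.orthogonal (ℤ ∙ h))) ⟨v, hv⟩ ⟨v, hv⟩ = 1 + 1 := hvv
  refine (B.restrict (B.orthogonal (ℤ ∙ h))).natCard_quot_and_isOrientationPreserving_eq_natCard_quot hNs hNnd _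
    (normTwoReflectionEquiv hNs ⟨v, hv⟩ 1 hvv' (one_mul 1))
    (discriminantGroupCongr_normTwoReflectionEquiv _ hNs _ (Or.inl rfl) hvv' (one_mul 1))
    (by rw [isOrientationPreserving_normTwoReflectionEquiv_iff _ hNs hNnd]; norm_num) ?_
  -- `O(L, h)|_{h^⊥}` is stable under `γ ↦ γ σ_v|`: extend by `σ_v ∈ O(L, h)`
  rintro γ ⟨G, hGh, hGn⟩
  have hhv : B h v = 0 := (B.mem_orthogonal_span_singleton_iff).1 hv
  refine ⟨G.trans (normTwoReflectionEquiv hB v 1 hvv (one_mul 1)), ?_, fun n ↦ ?_⟩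
  · rw [IsometryEquiv.trans_apply, hGh, normTwoReflectionEquiv_apply, hB.eq v h, hhv, mul_zero, zero_smul, sub_zero]
  · rw [IsometryEquiv.trans_apply, IsometryEquiv.trans_apply, normTwoReflectionEquiv_apply,
      normTwoReflectionEquiv_apply, hGn, Submodule.coe_sub, Submodule.coe_smul]
    rfl

variable {B} in
/-- **Prop. 4.12 (ii) with `O⁺` for `div h = 1`: `[O⁺(L, h) : Õ⁺(L, h)] = |O(q_L)|`** when `(h, h') = 1`, `(h, h) ≠ 0`,
`L` even non-degenerate and `h^⊥` contains an isotropic `u` and a `v` with `(u, v) = 1` (a hyperbolic plane — so that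
`O(h^⊥) → O(q_{h^⊥})` is onto, and `h^⊥` has the `(+2)`-vector `(1 − v²/2) u + v`): the companion's
`|O(L, h)|_{h^⊥} ∕ Õ| = |O(q_L)|` together with §3's transfer — the index Remark 3.4 asks for.
[cite: GritsenkoHulekSankaran2010Symplectic, §3 Remark 3.4 and §4 Prop. 4.12 (ii) (`f = 1`)] [cite: Nikulin1980, Thm. 1.14.2] -/
theorem natCard_quot_exists_isOrientationPreserving_apply_eq_of_apply_eq_one_of_isotropic (hBn : B.Nondegenerate)
    (hB : B.IsSymm) (he : B.IsEven) {h h' : M} (hh : B h h ≠ 0) (hh' : B h h' = 1) {u v : M}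
    (hu : u ∈ B.orthogonal (ℤ ∙ h)) (hv : v ∈ B.orthogonal (ℤ ∙ h)) (huu : B u u = 0) (huv : B u v = 1) :
    Nat.card (Quot fun γ γ' : {γ : (B.restrict (B.orthogonal (ℤ ∙ h))).IsometryEquiv (B.restrict (B.orthogonal (ℤ ∙ h))) //
        ∃ G : B.IsometryEquiv B, G.IsOrientationPreserving ∧ G h = h ∧ ∀ n : B.orthogonal (ℤ ∙ h), G n = γ n} ↦
          γ.1.discriminantGroupCongr = γ'.1.discriminantGroupCongr) =
      Nat.card {τ : B.discriminantGroup ≃ₗ[ℤ] B.discriminantGroup //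
        ∀ b, B.discriminantQuad hBn hB he (τ b) = B.discriminantQuad hBn hB he b} := by
  -- the `(+2)`-vector `w = (1 − a) u + v`, `v² = 2a`
  obtain ⟨a, ha⟩ := he v
  have hw : (1 - a) • u + v ∈ B.orthogonal (ℤ ∙ h) := add_mem (Submodule.smul_mem _ _ hu) hv
  have hww : B ((1 - a) • u + v) ((1 - a) • u + v) = 1 + 1 := by
    simp only [map_add, map_smul, LinearMap.add_apply, LinearMap.smul_apply, smul_eq_mul, huu, huv, hB.eq v u, ha]
    ring
  rw [B.natCard_quot_exists_isOrientationPreserving_apply_eq_eq hBn hB hh hw hww]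
  exact B.natCard_quot_exists_isometryEquiv_apply_eq_of_apply_eq_one_of_isotropic hBn hB he hh hh' hu hv huu huv

end Stabiliser

end LinearMap.BilinForm

/-! ### §4 Models: `Λ_d = ℓ^⊥ ⊂ Λ_{K3}`, `L_{2d}`, and the split `h_d` in `2E₈(−1) ⊕ 2U ⊕ ⟨−2t⟩`,
`E₈(−1)^{⊕m} ⊕ U^{⊕(k+2)} ⊕ ⟨−2t⟩` -/

namespace Literature.Topology.FourManifolds

open LinearMap.BilinForm

section K3

variable (d : ℕ)

/-- **`[O⁺(Λ_d) : Õ⁺(Λ_d)] = 2^{ρ(d)}`** for `Λ_d = ℓ^⊥ ⊂ Λ_{K3}`, `ℓ` primitive with `(ℓ)² = 2d > 0`: the classes of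
orientation-preserving isometries of `ℓ^⊥` with the same action on `A_{ℓ^⊥}` number `|O(q_{Λ_d})| = 2^{ρ(d)}`
(`ℓ^⊥ ≅ L_{2d} ⊃ U^{⊕2}`). GHS: "`N = [O⁺(L):Õ⁺(L)]`", `N = |O(q_{L_{2d}})| = 2^{ρ(d)}`; the modular group of
`ℱ_{2d} = Õ⁺(L_{2d})∖𝒟` has index `2^{ρ(d)}` in `O⁺(L_{2d})`.
[cite: GritsenkoHulekSankaran2007HM, §4 Lemma 4.2 (middle row), Lemma 4.3] [cite: Huybrechts2016K3, Ch. 6 §3.2, Ch. 14 Cor. 2.7 and Example 1.11 (i)] -/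
theorem natCard_quot_isOrientationPreserving_k3Lattice_orthogonal (hd : 0 < d) {ℓ : K3Index → ℤ}
    (hℓ : Matrix.toBilin' k3Gram ℓ ℓ = 2 * d)
    (hℓsat : ∀ (k : ℤ) (w : K3Index → ℤ), k ≠ 0 → k • w ∈ ℤ ∙ ℓ → w ∈ ℤ ∙ ℓ) :
    Nat.card (Quot fun g g' : {g : ((Matrix.toBilin' k3Gram).restrict
          ((Matrix.toBilin' k3Gram).orthogonal (ℤ ∙ ℓ))).IsometryEquiv
        ((Matrix.toBilin' k3Gram).restrict ((Matrix.toBilin' k3Gram).orthogonal (ℤ ∙ ℓ))) // g.IsOrientationPreserving} ↦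
        g.1.discriminantGroupCongr = g'.1.discriminantGroupCongr) = 2 ^ d.primeFactors.card := by
  have hℓ0 : ℓ ≠ 0 := by
    intro h0
    subst h0
    simp only [map_zero] at hℓ
    omega
  obtain ⟨hsC, heC, hC⟩ := k3Lattice_restrict_orthogonal_isEven_nondegenerate hℓ (by exact_mod_cast hd.ne') hℓsat
  obtain ⟨e⟩ := k3Lattice_restrict_orthogonal_equivalent hℓ hℓ0 hℓsat
  obtain ⟨hQ, hsQ, heQ⟩ := nondegenerate_isSymm_isEven_neg_twoMul_smul_mul_prod_pi_neg_e8Form d hd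
  obtain ⟨e'⟩ := latticeL2d_equivalent_prod_hyperbolicSum d
  rw [natCard_quot_isOrientationPreserving_eq_natCard_discriminantIsometry _ hC hsC heC _ hQ hsQ heQ
    (by norm_num : 0 < 2) ⟨e.trans e'⟩]
  exact natCard_discriminantIsometry_restrict_orthogonal d _ isSymm_toBilin'_k3Gram isUnimodular_toBilin'_k3Gram
    isEven_toBilin'_k3Gram hd hℓ hℓsat hC hsC heC

/-- **`[O⁺(L_{2d}) : Õ⁺(L_{2d})] = 2^{ρ(d)}`** for the model `L_{2d} = E₈(−1)^{⊕2} ⊕ U^{⊕2} ⊕ ℤ(−2d)` (`d ≥ 1`).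
[cite: GritsenkoHulekSankaran2007HM, §4 Lemmas 4.2 (middle row), 4.3] -/
theorem natCard_quot_isOrientationPreserving_latticeL2d (hd : 0 < d) :
    Nat.card (Quot fun g g' : {g : (((LinearMap.BilinForm.pi fun _ : Fin 2 ↦ -e8Form).prod (hyperbolicSum 2)).prod
          ((-(2 * d : ℤ)) • LinearMap.mul ℤ ℤ)).IsometryEquiv
        (((LinearMap.BilinForm.pi fun _ : Fin 2 ↦ -e8Form).prod (hyperbolicSum 2)).prod
          ((-(2 * d : ℤ)) • LinearMap.mul ℤ ℤ)) // g.IsOrientationPreserving} ↦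
        g.1.discriminantGroupCongr = g'.1.discriminantGroupCongr) = 2 ^ d.primeFactors.card := by
  obtain ⟨hQ, hsQ, heQ⟩ := nondegenerate_isSymm_isEven_neg_twoMul_smul_mul_prod_pi_neg_e8Form d hd
  obtain ⟨e⟩ := latticeL2d_equivalent_prod_hyperbolicSum d
  have h₁ := e.symm.nondegenerate (hQ.prod (isUnimodular_hyperbolicSum 2).nondegenerate)
  have h₂ := e.symm.isSymm (hsQ.prod (isSymm_hyperbolicSum 2))
  have h₃ := e.symm.isEven (isEven_prod_iff.2 ⟨heQ, isEven_hyperbolicSum 2⟩)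
  rw [natCard_quot_isOrientationPreserving_eq_natCard_discriminantIsometry _ h₁ h₂ h₃ _ hQ hsQ heQ
    (by norm_num : 0 < 2) ⟨e⟩]
  exact natCard_discriminantIsometry_latticeL2d d hd h₁ h₂ h₃

end K3

section Split

/-- **`[O⁺(L, h_d) : Õ⁺(L, h_d)] = 2^{ρ(t)}` for the rank-21 model and a split polarisation**: for `h_d = e₁ + d f₁ ∈
L = 2E₈(−1) ⊕ 2U ⊕ ⟨−2t⟩` (`d ≠ 0`, `t ≥ 1`) the restrictions of `O⁺(L, h_d)` to `h_d^⊥`, modulo those inducing the same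
isometry of `q_{h_d^⊥}` (i.e. modulo `Õ⁺(h_d^⊥) ≅ Õ⁺(L, h_d)`), number `|O(q_L)| = 2^{ρ(t)}` — the companion's count for
`O(L, h_d)` transferred along `σ_{e₂+f₂}`, `e₂ + f₂ ∈ h_d^⊥`. [cite: GritsenkoHulekSankaran2010Symplectic, §3 Remark 3.4, §4 Prop. 4.12 (ii) and Example 4.8 (`f = 1`)] [cite: GritsenkoHulekSankaran2007HM, §4 Lemmas 4.2, 4.3] -/
theorem natCard_quot_exists_isOrientationPreserving_apply_eq_latticeL2t_split {t : ℕ} (ht : 0 < t) {d : ℤ} (hd : d ≠ 0)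
    (h₁ : (((LinearMap.BilinForm.pi fun _ : Fin 2 ↦ -e8Form).prod (hyperbolicSum 2)).prod
        ((-(2 * t : ℤ)) • LinearMap.mul ℤ ℤ)).Nondegenerate)
    (h₂ : (((LinearMap.BilinForm.pi fun _ : Fin 2 ↦ -e8Form).prod (hyperbolicSum 2)).prod
        ((-(2 * t : ℤ)) • LinearMap.mul ℤ ℤ)).IsSymm)
    (h₃ : (((LinearMap.BilinForm.pi fun _ : Fin 2 ↦ -e8Form).prod (hyperbolicSum 2)).prod
        ((-(2 * t : ℤ)) • LinearMap.mul ℤ ℤ)).IsEven) :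
    Nat.card (Quot fun γ γ' : {γ : ((((LinearMap.BilinForm.pi fun _ : Fin 2 ↦ -e8Form).prod (hyperbolicSum 2)).prod
          ((-(2 * t : ℤ)) • LinearMap.mul ℤ ℤ)).restrict
          ((((LinearMap.BilinForm.pi fun _ : Fin 2 ↦ -e8Form).prod (hyperbolicSum 2)).prod
            ((-(2 * t : ℤ)) • LinearMap.mul ℤ ℤ)).orthogonal
            (ℤ ∙ (((0 : Fin 2 → Fin 8 → ℤ), ((Pi.single 0 1 : Fin 2 → ℤ), d • (Pi.single 0 1 : Fin 2 → ℤ))), (0 : ℤ))))).IsometryEquiv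
          ((((LinearMap.BilinForm.pi fun _ : Fin 2 ↦ -e8Form).prod (hyperbolicSum 2)).prod
            ((-(2 * t : ℤ)) • LinearMap.mul ℤ ℤ)).restrict
            ((((LinearMap.BilinForm.pi fun _ : Fin 2 ↦ -e8Form).prod (hyperbolicSum 2)).prod
              ((-(2 * t : ℤ)) • LinearMap.mul ℤ ℤ)).orthogonal
              (ℤ ∙ (((0 : Fin 2 → Fin 8 → ℤ), ((Pi.single 0 1 : Fin 2 → ℤ), d • (Pi.single 0 1 : Fin 2 → ℤ))), (0 : ℤ))))) //
        ∃ G : (((LinearMap.BilinForm.pi fun _ : Fin 2 ↦ -e8Form).prod (hyperbolicSum 2)).prod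
            ((-(2 * t : ℤ)) • LinearMap.mul ℤ ℤ)).IsometryEquiv
            (((LinearMap.BilinForm.pi fun _ : Fin 2 ↦ -e8Form).prod (hyperbolicSum 2)).prod
              ((-(2 * t : ℤ)) • LinearMap.mul ℤ ℤ)),
          G.IsOrientationPreserving ∧
          G (((0 : Fin 2 → Fin 8 → ℤ), ((Pi.single 0 1 : Fin 2 → ℤ), d • (Pi.single 0 1 : Fin 2 → ℤ))), (0 : ℤ)) =
              (((0 : Fin 2 → Fin 8 → ℤ), ((Pi.single 0 1 : Fin 2 → ℤ), d • (Pi.single 0 1 : Fin 2 → ℤ))), (0 : ℤ)) ∧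
            ∀ n : (((LinearMap.BilinForm.pi fun _ : Fin 2 ↦ -e8Form).prod (hyperbolicSum 2)).prod
                ((-(2 * t : ℤ)) • LinearMap.mul ℤ ℤ)).orthogonal
                (ℤ ∙ (((0 : Fin 2 → Fin 8 → ℤ), ((Pi.single 0 1 : Fin 2 → ℤ), d • (Pi.single 0 1 : Fin 2 → ℤ))), (0 : ℤ))),
              G n = γ n} ↦
        γ.1.discriminantGroupCongr = γ'.1.discriminantGroupCongr) = 2 ^ t.primeFactors.card := by
  obtain ⟨hh, -, -, -, -, -⟩ := latticeL2t_split_polarisation_apply t d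
  have hh0 : (((LinearMap.BilinForm.pi fun _ : Fin 2 ↦ -e8Form).prod (hyperbolicSum 2)).prod
      ((-(2 * t : ℤ)) • LinearMap.mul ℤ ℤ)) ((0, (Pi.single 0 1, d • Pi.single 0 1)), 0)
      ((0, (Pi.single 0 1, d • Pi.single 0 1)), 0) ≠ 0 := by
    rw [hh]
    exact mul_ne_zero two_ne_zero hd
  -- the `(+2)`-vector `e₂ + f₂ ∈ h_d^⊥`
  have hv : (((LinearMap.BilinForm.pi fun _ : Fin 2 ↦ -e8Form).prod (hyperbolicSum 2)).prod
      ((-(2 * t : ℤ)) • LinearMap.mul ℤ ℤ)) ((0, (Pi.single 0 1, d • Pi.single 0 1)), 0)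
      ((0, (Pi.single 1 1, Pi.single 1 1)), 0) = 0 := by
    simp [LinearMap.BilinForm.prod_apply]
  have hvv : (((LinearMap.BilinForm.pi fun _ : Fin 2 ↦ -e8Form).prod (hyperbolicSum 2)).prod
      ((-(2 * t : ℤ)) • LinearMap.mul ℤ ℤ)) ((0, (Pi.single 1 1, Pi.single 1 1)), 0)
      ((0, (Pi.single 1 1, Pi.single 1 1)), 0) = 1 + 1 := by
    simp [LinearMap.BilinForm.prod_apply]
  rw [LinearMap.BilinForm.natCard_quot_exists_isOrientationPreserving_apply_eq_eq _ h₁ h₂ hh0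
    ((LinearMap.BilinForm.mem_orthogonal_span_singleton_iff _).2 hv) hvv]
  exact natCard_quot_exists_isometryEquiv_apply_eq_latticeL2t_split ht hd h₁ h₂ h₃

/-- **`[O⁺(L, h_d) : Õ⁺(L, h_d)] = 2^{ρ(t)}` in the models `L = E₈(−1)^{⊕m} ⊕ U^{⊕(k+2)} ⊕ ⟨−2t⟩`** — GHS 2010's
`L_{2t} = L_{K3} ⊕ ⟨−2t⟩ = 2E₈(−1) ⊕ 3U ⊕ ⟨−2t⟩` being `m = 2`, `k = 1` — for the split `h_d = e₁ + d f₁` (`d ≠ 0`,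
`t ≥ 1`): the number of liftings `φ̃` of Remark 3.4 for split polarisations, `[O⁺(L_{2t}, h_d) : Õ⁺(L_{2t}, h_d)] =
|O(L_{2t}, h_d)/Õ(L_{2t}, h_d)| = 2^{ρ(t)}`. [cite: GritsenkoHulekSankaran2010Symplectic, §3 Remark 3.4 and §4 Prop. 4.12 (ii) (`f = 1`: order `2^{ρ(t)}`)] [cite: GritsenkoHulekSankaran2007HM, §4 Lemmas 4.2, 4.3] -/
theorem natCard_quot_exists_isOrientationPreserving_apply_eq_model_split (m k : ℕ) {t : ℕ} (ht : 0 < t) {d : ℤ}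
    (hd : d ≠ 0)
    (h₁ : (((LinearMap.BilinForm.pi fun _ : Fin m ↦ -e8Form).prod (hyperbolicSum (k + 2))).prod
        ((-(2 * t : ℤ)) • LinearMap.mul ℤ ℤ)).Nondegenerate)
    (h₂ : (((LinearMap.BilinForm.pi fun _ : Fin m ↦ -e8Form).prod (hyperbolicSum (k + 2))).prod
        ((-(2 * t : ℤ)) • LinearMap.mul ℤ ℤ)).IsSymm)
    (h₃ : (((LinearMap.BilinForm.pi fun _ : Fin m ↦ -e8Form).prod (hyperbolicSum (k + 2))).prod
        ((-(2 * t : ℤ)) • LinearMap.mul ℤ ℤ)).IsEven) :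
    Nat.card (Quot fun γ γ' : {γ : ((((LinearMap.BilinForm.pi fun _ : Fin m ↦ -e8Form).prod (hyperbolicSum (k + 2))).prod
          ((-(2 * t : ℤ)) • LinearMap.mul ℤ ℤ)).restrict
          ((((LinearMap.BilinForm.pi fun _ : Fin m ↦ -e8Form).prod (hyperbolicSum (k + 2))).prod
            ((-(2 * t : ℤ)) • LinearMap.mul ℤ ℤ)).orthogonal
            (ℤ ∙ (((0 : Fin m → Fin 8 → ℤ), ((Pi.single 0 1 : Fin (k + 2) → ℤ), d • (Pi.single 0 1 : Fin (k + 2) → ℤ))),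
              (0 : ℤ))))).IsometryEquiv
          ((((LinearMap.BilinForm.pi fun _ : Fin m ↦ -e8Form).prod (hyperbolicSum (k + 2))).prod
            ((-(2 * t : ℤ)) • LinearMap.mul ℤ ℤ)).restrict
            ((((LinearMap.BilinForm.pi fun _ : Fin m ↦ -e8Form).prod (hyperbolicSum (k + 2))).prod
              ((-(2 * t : ℤ)) • LinearMap.mul ℤ ℤ)).orthogonal
              (ℤ ∙ (((0 : Fin m → Fin 8 → ℤ), ((Pi.single 0 1 : Fin (k + 2) → ℤ), d • (Pi.single 0 1 : Fin (k + 2) → ℤ))),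
                (0 : ℤ))))) //
        ∃ G : (((LinearMap.BilinForm.pi fun _ : Fin m ↦ -e8Form).prod (hyperbolicSum (k + 2))).prod
            ((-(2 * t : ℤ)) • LinearMap.mul ℤ ℤ)).IsometryEquiv
            (((LinearMap.BilinForm.pi fun _ : Fin m ↦ -e8Form).prod (hyperbolicSum (k + 2))).prod
              ((-(2 * t : ℤ)) • LinearMap.mul ℤ ℤ)),
          G.IsOrientationPreserving ∧
          G (((0 : Fin m → Fin 8 → ℤ), ((Pi.single 0 1 : Fin (k + 2) → ℤ), d • (Pi.single 0 1 : Fin (k + 2) → ℤ))), (0 : ℤ)) =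
              (((0 : Fin m → Fin 8 → ℤ), ((Pi.single 0 1 : Fin (k + 2) → ℤ), d • (Pi.single 0 1 : Fin (k + 2) → ℤ))),
                (0 : ℤ)) ∧
            ∀ n : (((LinearMap.BilinForm.pi fun _ : Fin m ↦ -e8Form).prod (hyperbolicSum (k + 2))).prod
                ((-(2 * t : ℤ)) • LinearMap.mul ℤ ℤ)).orthogonal
                (ℤ ∙ (((0 : Fin m → Fin 8 → ℤ), ((Pi.single 0 1 : Fin (k + 2) → ℤ), d • (Pi.single 0 1 : Fin (k + 2) → ℤ))),
                  (0 : ℤ))),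
              G n = γ n} ↦
        γ.1.discriminantGroupCongr = γ'.1.discriminantGroupCongr) = 2 ^ t.primeFactors.card := by
  obtain ⟨hh, -, -, -, -, -⟩ := model_split_polarisation_apply m k t d
  have hh0 : (((LinearMap.BilinForm.pi fun _ : Fin m ↦ -e8Form).prod (hyperbolicSum (k + 2))).prod
      ((-(2 * t : ℤ)) • LinearMap.mul ℤ ℤ)) ((0, (Pi.single 0 1, d • Pi.single 0 1)), 0)
      ((0, (Pi.single 0 1, d • Pi.single 0 1)), 0) ≠ 0 := by
    rw [hh]
    exact mul_ne_zero two_ne_zero hd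
  -- the `(+2)`-vector `e₂ + f₂ ∈ h_d^⊥`
  have hv : (((LinearMap.BilinForm.pi fun _ : Fin m ↦ -e8Form).prod (hyperbolicSum (k + 2))).prod
      ((-(2 * t : ℤ)) • LinearMap.mul ℤ ℤ)) ((0, (Pi.single 0 1, d • Pi.single 0 1)), 0)
      ((0, (Pi.single 1 1, Pi.single 1 1)), 0) = 0 := by
    simp [LinearMap.BilinForm.prod_apply]
  have hvv : (((LinearMap.BilinForm.pi fun _ : Fin m ↦ -e8Form).prod (hyperbolicSum (k + 2))).prod
      ((-(2 * t : ℤ)) • LinearMap.mul ℤ ℤ)) ((0, (Pi.single 1 1, Pi.single 1 1)), 0)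
      ((0, (Pi.single 1 1, Pi.single 1 1)), 0) = 1 + 1 := by
    simp [LinearMap.BilinForm.prod_apply]
  rw [LinearMap.BilinForm.natCard_quot_exists_isOrientationPreserving_apply_eq_eq _ h₁ h₂ hh0
    ((LinearMap.BilinForm.mem_orthogonal_span_singleton_iff _).2 hv) hvv]
  exact natCard_quot_exists_isometryEquiv_apply_eq_model_split m k ht hd h₁ h₂ h₃

end Split

end Literature.Topology.FourManifolds
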